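import Literature.MathematicalPhysics.QuantumFieldTheory.Balaban1983to89.B4ThmTorusBox
import Literature.MathematicalPhysics.QuantumFieldTheory.Balaban1983to89.B4ThmJoinFam

/-!
# `Balaban1983to89.B4ThmTorusJoinFam` — [Balaban1983RegularityDecay] THEOREM p. 573 (1.9)–(1.12) WITH ONE SET OF
# CONSTANTS ON THE JOIN OF THE TWO TORUS FAMILIES: torus region pairs `Ω ⊂ Ω₀ ⊂ T_η` (`R₀` live, waived for `Ω = T_η`)
# ⊕ proper parallelepipeds `Ω ⊂ T_η` (NO restriction — the printed waiver); and the join of all FOUR (1.7)-regular families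
# of the tree (lattice big-block pairs, lattice parallelepiped pairs, torus pairs, torus parallelepipeds)

statement-level skeleton of published theorems with citation tags; proofs where landed; nothing here is a claim about the Yang–Mills mass gap

CITATION HEADER.  T. Bałaban, *Regularity and decay of lattice Green's functions*, Commun. Math. Phys. **89** (1983)
571–597, doi:10.1007/bf01214744 [Balaban1983RegularityDecay] (cell paper B4; held text
`paper:balaban1983-cmp89-regularity-decay`, journal page = PDF page + 570; p. 573 [PDF 3] Theorem (1.9)–(1.12) incl. its
last sentence «For some simple sets Ω, e.g. for rectangular parallelepipeds, the inequalities hold without any restrictions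
on the points x, x′, i.e. for all x, x′ ∈ Ω.», p. 572 [PDF 2] «Another common case is to consider operators on subsets of a
torus T_η»).  Seat `pub-ymgap-dag-p3` gen 4 (Track A, YM-PLAN §2 node N01 = [B4]; HOME `run/shared/lean/pub/pub-ymgap/`):
the join lemma announced in the seat's gen-3 handoff — a candidate `famE` for a later Stage-1 re-pin of NODE 00's B4 group
(the decision is node00-def's ∕ the leads', not made here) on which the `rect` word of N01's cross-read (XREAD-B4 §2–§4:
waiver typed on the full torus only) shrinks to its residual (wrapping bands of `T_η`; boxes inside a general `Ω₀`).
Imports: dag-p3 g3 `B4ThmTorusBox` (`torusBoxFam`, `thmPrintedNN_torusBoxFam`, `hypotheses_met`), dag-p3 g2 `B4ThmJoinFam`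
(`thmPrintedNN_sumElim`, the sign lemmas, `thmPrintedNN_join3`, `join3_nonvacuous`).

WHAT THIS MODULE PROVES (kernel, sorry-free, theorems only).
* §1 `torusBoxFam_signs` — the torus-parallelepiped family has non-negative distance ∕ sup-norm functionals (they are
  r01's torus functionals `tsdist1`, `tcdist`, `tbdistS`, `supN` at the torus pair `toInst`).
* §2 **`thmPrintedNN_torusJoin`** — `ThmPrintedNN` on (T) torus pairs ⊕ (TB) torus parallelepipeds: for every `α ∈ [0,1)`
  ONE `(δ₀, c₀, R₀, e₁)` for both kinds, the `R₀` restriction waived exactly where the summand's `rect` holds (`Ω = T_η` in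
  (T); every instance of (TB)); **`thmPrintedNN_join4`** — ((L) ⊕ (B)) ⊕ (T) ⊕ (TB): every (1.7)-regular η-family of the
  tree with one set of constants per `α`.
* §3 `leafNN_torusJoin` — the four conjuncts of the DAG leaf `b4` (NN form) with `famE :=` the torus join and the
  `famU ∕ famF ∕ (d, N)` legs of `B4LeafRegular.leafNN_torusPairFam` (the legs of record) unchanged;
  `torusJoin_nonvacuous` — both summands have members meeting `regular ∧ bigBlocks ∧ 0 < e ≤ e₁` for every `e₁ > 0`.
HONEST SCOPE.  Bookkeeping over existing kernel theorems (r01 g9, dag-p3 g2∕g3); no analytic estimate is proved here.  The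
summands keep their own side conditions (`bigBlocks`: `Kmod`-block unions with `Kmod ∣ P_ν` on (T), additionally
`KmodNC ∣ Ms_ν` on (TB); (1.7) on `Ω₀` resp. `T_η` with torus differences; fine torus period `≥ 3`; `d ≥ 1` for (TB));
the waiver is NOT extended to wrapping bands of `T_η` nor to boxes inside a general `Ω₀`; `lhs19` = sup over admissible
torus contours and every other reading as in the lineages.  Count-neutral for YM-PLAN (typed 28∕28; discharged count
unmoved; a re-pin of `famE` is NODE 00's ∕ the leads' decision); nothing here concerns the continuum, ℝ⁴, OS axioms, a
mass gap or the Clay problem.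
-/

namespace Literature.MathematicalPhysics.QuantumFieldTheory.Balaban1983to89.B4ThmTorusJoinFam

open Literature.MathematicalPhysics.QuantumFieldTheory.Balaban1983to89
open Literature.MathematicalPhysics.QuantumFieldTheory.Balaban1983to89.B4 (EtaSetting Ineq19_110 Ineq111_112
  Prop23Printed Prop31Printed Sect5ThmUniform)
open Literature.MathematicalPhysics.QuantumFieldTheory.Balaban1983to89.B4Ineq111ZeroNestEta (ThmPrintedNN)
open Literature.MathematicalPhysics.QuantumFieldTheory.Balaban1983to89.B4GaugeCovariance (OrthFlow)
open Literature.MathematicalPhysics.QuantumFieldTheory.Balaban1983to89.B4Lemma22Reduce231 (supN_nonneg)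
open Literature.MathematicalPhysics.QuantumFieldTheory.Balaban1983to89.B4ThmRegionPairEta (RegionPairInst regionPairFam
  Kmod)
open Literature.MathematicalPhysics.QuantumFieldTheory.Balaban1983to89.B4TorusPairFam (TorusPairInst torusPairFam
  tsdist1_nonneg tcdist_nonneg tbdistS_nonneg)
open Literature.MathematicalPhysics.QuantumFieldTheory.Balaban1983to89.B4ThmTorusPairEta (thmPrintedNN_torusPairFam)
open Literature.MathematicalPhysics.QuantumFieldTheory.Balaban1983to89.B4ThmBoxPairEta (BoxPairInst)
open Literature.MathematicalPhysics.QuantumFieldTheory.Balaban1983to89.B4ThmBoxPairEtaNoCollar (boxPairFamNC KmodNC)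
open Literature.MathematicalPhysics.QuantumFieldTheory.Balaban1983to89.B4ThmTorusBox (TorusBoxInst torusBoxFam
  thmPrintedNN_torusBoxFam)
open Literature.MathematicalPhysics.QuantumFieldTheory.Balaban1983to89.B4ThmJoinFam (thmPrintedNN_sumElim
  regionPairFam_signs boxPairFamNC_signs torusPairFam_signs thmPrintedNN_join3 join3_nonvacuous)
open Literature.MathematicalPhysics.QuantumFieldTheory.Balaban1983to89.B4Prop23RegularWindow (regularFieldRegionsW
  prop23Printed_regularWindow)
open Literature.MathematicalPhysics.QuantumFieldTheory.Balaban1983to89.B4Prop31Regular (regularFormSetting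
  prop31Printed_regularRegion)
open Literature.MathematicalPhysics.QuantumFieldTheory.Balaban1983to89.B4Sect5Proof (sect5ThmUniform_holds)
open scoped Matrix

/-! ## §1. The sign facts of the torus-parallelepiped family -/

section Signs

variable {ι : Type} [Fintype ι] [DecidableEq ι] (F : OrthFlow ι) (d ℓ : ℕ) (amin aplus m2plus creg β : ℝ) (K K' : ℕ)

/-- the torus-parallelepiped family (TB) has non-negative distance and sup-norm functionals (r01's torus sup-metric
functionals at the torus pair `toInst`). [cite: Balaban1983RegularityDecay, Theorem p.573 and p.572 «operators on subsets of a torus T_η», dictionary (`dist`, `‖f‖_∞ ≥ 0`)] -/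
theorem torusBoxFam_signs (j : TorusBoxInst d ℓ amin aplus m2plus) :
    (∀ x f, 0 ≤ (torusBoxFam F d ℓ amin aplus m2plus creg β K K' j).sdist1 x f) ∧
    (∀ x x' f, 0 ≤ (torusBoxFam F d ℓ amin aplus m2plus creg β K K' j).sdist2 x x' f) ∧
    (∀ x, 0 ≤ (torusBoxFam F d ℓ amin aplus m2plus creg β K K' j).bdist1 x) ∧
    (∀ x x', 0 ≤ (torusBoxFam F d ℓ amin aplus m2plus creg β K K' j).bdist2 x x') ∧
    (∀ f, 0 ≤ (torusBoxFam F d ℓ amin aplus m2plus creg β K K' j).bdistS f) ∧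
    (∀ f, 0 ≤ (torusBoxFam F d ℓ amin aplus m2plus creg β K K' j).supNorm f) :=
  ⟨fun x f => tsdist1_nonneg j.P x f, fun x x' f => le_min (tsdist1_nonneg j.P x f) (tsdist1_nonneg j.P x' f),
    fun x => tcdist_nonneg j.P x, fun x x' => le_min (tcdist_nonneg j.P x) (tcdist_nonneg j.P x'),
    fun f => tbdistS_nonneg j.P f, fun f => supN_nonneg f⟩

end Signs

/-! ## §2. The joins: the two torus families; all four families -/

section Join

variable {ι : Type} [Fintype ι] [DecidableEq ι] (F : OrthFlow ι) {ℓ₁ : ℝ} (hℓ₁ : 0 ≤ ℓ₁)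
  (hLip : ∀ t (v : ι → ℝ), ((F.U t - 1) *ᵥ v) ⬝ᵥ ((F.U t - 1) *ᵥ v) ≤ (ℓ₁ * t) ^ 2 * (v ⬝ᵥ v))
  (d ℓ : ℕ) (hd : 1 ≤ d) (hℓ : 1 ≤ ℓ) (amin aplus m2plus : ℝ) (ha : 0 < amin)
  (creg β : ℝ) (hcreg : 0 ≤ creg) (hβ : 0 < β)

include hcreg hβ in
/-- **THEOREM p. 573 ON THE TORUS `T_η` WITH THE PARALLELEPIPED WAIVER, ONE SET OF CONSTANTS**: `ThmPrintedNN` on the join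
of (T) r01's torus region pairs `Ω ⊂ Ω₀ ⊂ T_η` (`R₀` restriction live, waived for `Ω = T_η`; block size `Kmod`) and
(TB) the proper parallelepipeds `Ω ⊂ Ω₀ = T_η` (`rect := True`: (1.9)–(1.12) for ALL `x, x′ ∈ Ω`; moduli `Kmod`,
`KmodNC`), at every (1.7)-regular torus field with the family's `(c, β)`, for a Lipschitz orthogonal flow, `d ≥ 1`,
`L = ℓ+1 ≥ 2`, `a₋ > 0` — for every `α ∈ [0,1)` one `(δ₀, c₀, R₀, e₁)` (`min ∕ max` of the two lineage quadruples).
[cite: Balaban1983RegularityDecay, Theorem (1.9)–(1.12) p.573 incl. «for rectangular parallelepipeds, the inequalities hold without any restrictions on the points x, x′»; p.572 «operators on subsets of a torus T_η»] -/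
theorem thmPrintedNN_torusJoin :
    ThmPrintedNN (Sum.elim
      (torusPairFam F d ℓ amin aplus m2plus creg β (Kmod F hℓ₁ hLip d ℓ hℓ amin aplus m2plus ha))
      (torusBoxFam F d ℓ amin aplus m2plus creg β (Kmod F hℓ₁ hLip d ℓ hℓ amin aplus m2plus ha)
        (KmodNC F hℓ₁ hLip d ℓ hd hℓ amin aplus m2plus ha))) :=
  thmPrintedNN_sumElim _ _ (fun i => torusPairFam_signs F d ℓ amin aplus m2plus creg β _ i)
    (fun j => torusBoxFam_signs F d ℓ amin aplus m2plus creg β _ _ j)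
    (thmPrintedNN_torusPairFam F hℓ₁ hLip d ℓ hℓ amin aplus m2plus ha creg β hcreg hβ)
    (thmPrintedNN_torusBoxFam F hℓ₁ hLip d ℓ hd hℓ amin aplus m2plus ha creg β hcreg hβ)

include hcreg hβ in
/-- **THEOREM p. 573 ON EVERY (1.7)-REGULAR η-FAMILY OF THE TREE AT ONCE, ONE SET OF CONSTANTS**: `ThmPrintedNN` on the
join (((L) lattice big-block pairs ⊕ (B) lattice parallelepiped pairs) ⊕ (T) torus pairs) ⊕ (TB) torus parallelepipeds
— dag-p3 g2's `thmPrintedNN_join3` ⊕ dag-p3 g3's `thmPrintedNN_torusBoxFam`; the `R₀` restriction is waived exactly where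
the summand's `rect` holds (every instance of (B) and (TB); the instances `Ω = T_η` of (T)).
[cite: Balaban1983RegularityDecay, Theorem (1.9)–(1.12) p.573; p.572 «a lattice ηZ^d or its subsets … a torus T_η» (the two settings)] -/
theorem thmPrintedNN_join4 :
    ThmPrintedNN (Sum.elim (Sum.elim (Sum.elim
      (regionPairFam F d ℓ amin aplus m2plus creg β (Kmod F hℓ₁ hLip d ℓ hℓ amin aplus m2plus ha))
      (boxPairFamNC F d ℓ amin aplus m2plus creg β (KmodNC F hℓ₁ hLip d ℓ hd hℓ amin aplus m2plus ha)))
      (torusPairFam F d ℓ amin aplus m2plus creg β (Kmod F hℓ₁ hLip d ℓ hℓ amin aplus m2plus ha)))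
      (torusBoxFam F d ℓ amin aplus m2plus creg β (Kmod F hℓ₁ hLip d ℓ hℓ amin aplus m2plus ha)
        (KmodNC F hℓ₁ hLip d ℓ hd hℓ amin aplus m2plus ha))) := by
  refine thmPrintedNN_sumElim _ _ ?_ (fun j => torusBoxFam_signs F d ℓ amin aplus m2plus creg β _ _ j)
    (thmPrintedNN_join3 F hℓ₁ hLip d ℓ hd hℓ amin aplus m2plus ha creg β hcreg hβ)
    (thmPrintedNN_torusBoxFam F hℓ₁ hLip d ℓ hd hℓ amin aplus m2plus ha creg β hcreg hβ)
  rintro ((i | i) | i)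
  · exact regionPairFam_signs F d ℓ amin aplus m2plus creg β _ i
  · exact boxPairFamNC_signs F d ℓ amin aplus m2plus creg β _ i
  · exact torusPairFam_signs F d ℓ amin aplus m2plus creg β _ i

/-! ## §3. The four-conjunct leaf with the torus join as `famE`; non-vacuity of both summands -/

variable (hap : amin ≤ aplus) {a' : ℝ} (ha' : 0 < a') {a m2 C a₀ p : ℝ} (ha0 : 0 < a) (hm : 0 ≤ m2) (hC : 0 ≤ C)
  (ha₀ : 0 ≤ a₀) (hp : 0 < p) (d₅ N₅ : ℕ)

include hap hcreg hβ ha' ha0 hm hC ha₀ hp in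
/-- **THE DAG LEAF `b4` IN ITS `0 ≤ α` FORM, ALL FOUR CONJUNCTS, WITH `famE :=` THE TORUS JOIN**: Theorem p. 573
(`ThmPrintedNN`) on (T) ⊕ (TB) ∧ «Proposition 2.3 of [1]» (1.15)–(1.20) on the window family of nested unions of
`L`-blocks ∧ «Proposition 3.1′ of [2]» (1.21)–(1.22) on every finite union of unit blocks ∧ the Sect. 5 Theorem at
`(d₅, N₅)` — legs 2–4 exactly those of `B4LeafRegular.leafNN_torusPairFam` (NODE 00's legs of record); this 4-tuple is the
body of `DagDischargedII.B4LeafNN` for these families. [cite: Balaban1983RegularityDecay, Theorem (1.9)–(1.12) p.573; Prop. 2.3 of [1] (1.15)–(1.20) p.574; Prop. 3.1′ of [2] (1.21)–(1.22) p.574; Sect. 5 Theorem p.594] -/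
theorem leafNN_torusJoin :
    ThmPrintedNN (Sum.elim
      (torusPairFam F d ℓ amin aplus m2plus creg β (Kmod F hℓ₁ hLip d ℓ hℓ amin aplus m2plus ha))
      (torusBoxFam F d ℓ amin aplus m2plus creg β (Kmod F hℓ₁ hLip d ℓ hℓ amin aplus m2plus ha)
        (KmodNC F hℓ₁ hLip d ℓ hd hℓ amin aplus m2plus ha))) ∧
    Prop23Printed (regularFieldRegionsW (d := d) F (Nat.succ_le_succ (Nat.zero_le ℓ) : 1 ≤ ℓ + 1)
      amin aplus a' creg β m2plus) ∧
    Prop31Printed (regularFormSetting (d := d) F a m2 C a₀ p) ∧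
    Sect5ThmUniform d₅ N₅ :=
  ⟨thmPrintedNN_torusJoin F hℓ₁ hLip d ℓ hd hℓ amin aplus m2plus ha creg β hcreg hβ,
   prop23Printed_regularWindow F hℓ₁ hLip _ ha hap ha' hcreg hβ m2plus,
   prop31Printed_regularRegion F hℓ₁ hLip ha0 hm hC ha₀ hp,
   sect5ThmUniform_holds d₅ N₅⟩

include hap hcreg in
/-- **NON-VACUITY OF BOTH SUMMANDS**: for every threshold `e₁ > 0` each of the two joined torus families has an instance
meeting its antecedents `regular ∧ bigBlocks ∧ 0 < e ≤ e₁` at the block sizes of the join (`Kmod, KmodNC ≥ 16`) —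
witnesses are the lineages' (zero field on a one-cube torus region ∕ on a `KK′`-box of the torus of `3KK′` blocks).
[cite: Balaban1983RegularityDecay, Theorem p.573 «for e sufficiently small» (non-vacuity bookkeeping)] -/
theorem torusJoin_nonvacuous (hm2 : 0 ≤ m2plus) (e₁ : ℝ) (he₁ : 0 < e₁) :
    (∃ i : TorusPairInst d ℓ amin aplus m2plus,
      (torusPairFam F d ℓ amin aplus m2plus creg β (Kmod F hℓ₁ hLip d ℓ hℓ amin aplus m2plus ha) i).regular ∧
      (torusPairFam F d ℓ amin aplus m2plus creg β (Kmod F hℓ₁ hLip d ℓ hℓ amin aplus m2plus ha) i).bigBlocks ∧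
      0 < (torusPairFam F d ℓ amin aplus m2plus creg β (Kmod F hℓ₁ hLip d ℓ hℓ amin aplus m2plus ha) i).e ∧
      (torusPairFam F d ℓ amin aplus m2plus creg β (Kmod F hℓ₁ hLip d ℓ hℓ amin aplus m2plus ha) i).e ≤ e₁) ∧
    (∃ j : TorusBoxInst d ℓ amin aplus m2plus,
      (torusBoxFam F d ℓ amin aplus m2plus creg β (Kmod F hℓ₁ hLip d ℓ hℓ amin aplus m2plus ha)
        (KmodNC F hℓ₁ hLip d ℓ hd hℓ amin aplus m2plus ha) j).regular ∧
      (torusBoxFam F d ℓ amin aplus m2plus creg β (Kmod F hℓ₁ hLip d ℓ hℓ amin aplus m2plus ha)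
        (KmodNC F hℓ₁ hLip d ℓ hd hℓ amin aplus m2plus ha) j).bigBlocks ∧
      0 < (torusBoxFam F d ℓ amin aplus m2plus creg β (Kmod F hℓ₁ hLip d ℓ hℓ amin aplus m2plus ha)
        (KmodNC F hℓ₁ hLip d ℓ hd hℓ amin aplus m2plus ha) j).e ∧
      (torusBoxFam F d ℓ amin aplus m2plus creg β (Kmod F hℓ₁ hLip d ℓ hℓ amin aplus m2plus ha)
        (KmodNC F hℓ₁ hLip d ℓ hd hℓ amin aplus m2plus ha) j).e ≤ e₁) := by
  have hK : 1 ≤ Kmod F hℓ₁ hLip d ℓ hℓ amin aplus m2plus ha :=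
    le_trans (by norm_num)
      (Classical.choose_spec (B4ThmRegionPairEta.region_pair_members F hℓ₁ hLip d ℓ hℓ amin aplus m2plus ha)).1
  have hK' : 1 ≤ KmodNC F hℓ₁ hLip d ℓ hd hℓ amin aplus m2plus ha :=
    le_trans (by norm_num)
      (Classical.choose_spec
        (B4ThmBoxPairEtaNoCollar.box_pair_members_noCollar F hℓ₁ hLip d ℓ hd hℓ amin aplus m2plus ha)).1
  exact ⟨B4ThmTorusPairEta.hypotheses_met F d ℓ hap hm2 creg β hcreg _ hK e₁ he₁,
    B4ThmTorusBox.hypotheses_met F d ℓ hap hm2 creg β hcreg _ _ hK hK' e₁ he₁⟩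

end Join

end Literature.MathematicalPhysics.QuantumFieldTheory.Balaban1983to89.B4ThmTorusJoinFam
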